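import Literature.AlgebraicGeometry.Frobenioids.BaseCategoryTheoreticityInstances
import Literature.AlgebraicGeometry.Frobenioids.BaseCategoryTheoreticitySchemaRefutations
import Literature.AlgebraicGeometry.Frobenioids.EquivalenceIstrSquare
import Literature.AlgebraicGeometry.Frobenioids.EquivalenceThm34ivvOfThm34iii
import HarnessLib

/-!
# Frobenioids I, Theorem 3.4 (iv): the unit-trivialisation square at EVERY `Ψ^istr` as in Theorem 3.4 (i),
# and its non-vacuity at a genuine Frobenioid

Mochizuki, *The geometry of Frobenioids I: the general theory*, Kyushu J. Math. **62** (2008)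
293–400, Thm. 3.4 (i) p. 62 ll. 25–30 ("there exists a `1`-unique functor `Ψ^istr : C₁^istr → C₂^istr` that
fits into a `1`-commutative diagram" with the isotropification functors of Prop. 1.9 (v)) and Thm. 3.4 (iv)
p. 63 ll. 5–21 (the `1`-unique `Ψ^un-tr` over that `Ψ^istr`) [cite: MochizukiFrdI2008, Thm. 3.4 (iv) p.63].

PROOF-ONLY companion of `BaseCategoryTheoreticity.lean` (seat abc-iut-L1-t3) continuing
`BaseCategoryTheoreticityInstances.lean` (seat abc-iut-f-019; FACT-LIST row F-0906 `PreFrobenioidData.Thm34iv_untr`,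
a schema over a FREE functor `Ψ^istr`, universal closure false: `PreFrobenioidData.not_forall_thm34iv_untr`).
The faithful reading of the row quantifies `Ψ^istr` over "the functor of (i)", i.e. over the functors fitting
the `1`-commutative square of Thm. 3.4 (i); this file proves the typed statement for ALL of them:

* `PreFrobenioidData.OneUniqueSquare.of_iso_top`, `PreFrobenioidData.Thm34iv_untr.of_iso` — the typed square
  statements depend on the top functor only up to isomorphism (generic over `S_i : PreFrobenioidData`);
* `FrdI.nonempty_iso_congrFullSubcategory_of_oneCommutes` — for Frobenioids of quasi-isotropic type, every
  `Ψ^istr` fitting the square of (i) (isotropification functors `PreFrobenioid.isotropification` of seat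
  abc-iut-L1-t1, read in the §3 full subcategory through `ObjectProperty.ιOfLE`, as in seat abc-iut-w4-d088's
  `PreFrobenioid.thm34i_istr_ofFunctor`) is isomorphic to THE restriction `Ψ.congrFullSubcategory _` of `Ψ`
  ("the restriction of the isotropification functor to `C^istr` is isomorphic to the identity functor",
  Prop. 1.9 (v), `isotropificationRestrictIso`);
* `FrdI.thm34iv_untr_ofFunctor_of_thm34iv_of_oneCommutes` — hence the typed `Thm34iv_untr` at EVERY such `Ψ^istr`,
  from the typed preservation part `Thm34iv` for `Ψ`, `Ψ⁻¹` (the unconditional feed with `FrdI.Thm34iv_holds` is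
  the companion `BaseCategoryTheoreticityInstancesClosed.lean`);
* NON-VACUITY (`DegreeModel.thm34iv_untr_refl`, `…_conclusion`): for the standard-type Frobenioid of the degree
  model ([FrdI] Thm. 5.2; seat abc-iut-L1-d4) and `Ψ = 𝟭`, the typed `Thm34iv_untr` at THE `Ψ^istr` HOLDS with all
  antecedents discharged ((a) `DegreeModel.isOfStandardType`, (b) `hypB`, (c) `isFrobeniusSlim_D`; Thm. 3.4 (iv)
  over the FSM-type base by seat abc-iut-w4-d093/d088's `FrdI.thm34iv_ofFunctor_of_isOfFSMType'`) — the same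
  model on which the schema FAILS at a junk `Ψ^istr` (`DegreeModel.not_thm34iv_untr_const`): the universal
  closure of F-0906 is false only through its free parameter.

No definition; no statement of the paper is restated or strengthened; nothing here bears on [IUTchIII].
-/

namespace Literature.AlgebraicGeometry.Frobenioids

namespace PreFrobenioidData

open CategoryTheory

/-! ### The typed square statements are invariant under isomorphism of the top functor -/

/-- A `1`-unique `1`-commutative square stays one when its top arrow `T` is replaced by an isomorphic functor
(vocabulary of FrdI §0 p. 15). [cite: MochizukiFrdI2008, Thm. 3.4 (i) p.62] -/
theorem OneUniqueSquare.of_iso_top {X₁ : Type*} [Category X₁] {X₂ : Type*} [Category X₂] {Y₁ : Type*}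
    [Category Y₁] {Y₂ : Type*} [Category Y₂] {T T' : X₁ ⥤ X₂} {L : X₁ ⥤ Y₁} {R : X₂ ⥤ Y₂} {B : Y₁ ⥤ Y₂}
    (e : T ≅ T') (h : OneUniqueSquare T L R B) : OneUniqueSquare T' L R B := by
  obtain ⟨hB, ⟨i⟩, huniq⟩ := h
  exact ⟨hB, ⟨Functor.isoWhiskerRight e.symm R ≪≫ i⟩,
    fun B' ⟨i'⟩ => huniq B' ⟨Functor.isoWhiskerRight e R ≪≫ i'⟩⟩

universe w₁ w₂ v₁ v₁' v₂ v₂' u₁ u₁' u₂ u₂'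

variable {C₁ : Type u₁} [Category.{v₁} C₁] {D₁ : Type u₁'} [Category.{v₁'} D₁]
  {C₂ : Type u₂} [Category.{v₂} C₂] {D₂ : Type u₂'} [Category.{v₂'} D₂]
  (S₁ : PreFrobenioidData.{w₁} C₁ D₁) (S₂ : PreFrobenioidData.{w₂} C₂ D₂) (Ψ : C₁ ≌ C₂)

/-- The typed Thm. 3.4 (iv) unit-trivialisation statement `Thm34iv_untr S₁ S₂ Ψ Ψ^istr` depends on `Ψ^istr` only
up to isomorphism of functors (the square, its `1`-uniqueness and the rigidity of `Ψ^istr ⋙ (C₂^istr → C₂^un-tr)`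
all transport along `Ψ^istr ≅ Ψ^istr′`; `IsRigidFunctor.of_iso`, seat abc-iut-w4-d088).
[cite: MochizukiFrdI2008, Thm. 3.4 (iv) p.63] -/
theorem Thm34iv_untr.of_iso {Ψistr Ψistr' : S₁.Istr ⥤ S₂.Istr} (e : Ψistr ≅ Ψistr')
    (h : Thm34iv_untr S₁ S₂ Ψ Ψistr) : Thm34iv_untr S₁ S₂ Ψ Ψistr' := by
  intro hs₁ hs₂ hB hf₁ hf₂
  obtain ⟨L, hsq, hrig⟩ := h hs₁ hs₂ hB hf₁ hf₂
  refine ⟨L, hsq.of_iso_top e, fun h₁ h₂ => ?_⟩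
  obtain ⟨r₁, r₂⟩ := hrig h₁ h₂
  exact ⟨r₁.of_iso (Functor.isoWhiskerRight e S₂.toUntr), r₂⟩

end PreFrobenioidData

namespace FrdI

open CategoryTheory PreFrobenioidData

universe w v v' u u'

section Two

variable {D₁ : Type u} [Category.{v} D₁] {Φ₁ : D₁ᵒᵖ ⥤ CommMonCat.{w}} {C₁ : Type u'} [Category.{v'} C₁]
  {D₂ : Type u} [Category.{v} D₂] {Φ₂ : D₂ᵒᵖ ⥤ CommMonCat.{w}} {C₂ : Type u'} [Category.{v'} C₂]
  {F₁ : C₁ ⥤ ElemFrobenioid Φ₁} {F₂ : C₂ ⥤ ElemFrobenioid Φ₂}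

/-! ### Every `Ψ^istr` fitting the square of Thm. 3.4 (i) is THE restriction of `Ψ` -/

/-- For Frobenioids of quasi-isotropic type, every functor `Ψ^istr : C₁^istr ⥤ C₂^istr` that fits the
`1`-commutative square of Thm. 3.4 (i) with the isotropification functors `C_i → C_i^istr` of Prop. 1.9 (v)
(read in the §3 full subcategory through the identity-on-objects comparison `ObjectProperty.ιOfLE`) is
isomorphic to THE restriction `Ψ.congrFullSubcategory _` of `Ψ`: "the restriction of the isotropification
functor to `C^istr` is isomorphic to the identity functor" (Prop. 1.9 (v), seat abc-iut-L1-t1's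
`isotropificationRestrictIso`; the `1`-uniqueness argument of seat abc-iut-w4-d088's `thm34i_istr_ofFunctor`).
[cite: MochizukiFrdI2008, Thm. 3.4 (i) p.62] -/
theorem nonempty_iso_congrFullSubcategory_of_oneCommutes (hF₁ : PreFrobenioid.IsFrobenioid F₁)
    (hF₂ : PreFrobenioid.IsFrobenioid F₂) (hq₁ : (ofFunctor Φ₁ F₁).IsOfQuasiIsotropicType)
    (hq₂ : (ofFunctor Φ₂ F₂).IsOfQuasiIsotropicType) (Ψ : C₁ ≌ C₂)
    [(ofFunctor Φ₂ F₂).isotropicObjects.IsClosedUnderIsomorphisms]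
    (Ψistr : (ofFunctor Φ₁ F₁).Istr ⥤ (ofFunctor Φ₂ F₂).Istr)
    (hsq : OneCommutes Ψ.functor
      (PreFrobenioid.isotropification hF₂ ⋙ ObjectProperty.ιOfLE (PreFrobenioid.isotropicObjects_le_ofFunctor F₂))
      (PreFrobenioid.isotropification hF₁ ⋙ ObjectProperty.ιOfLE (PreFrobenioid.isotropicObjects_le_ofFunctor F₁))
      Ψistr) :
    Nonempty (Ψistr ≅ (Ψ.congrFullSubcategory (isotropicObjects_ofFunctor_inverseImage hF₁ hq₁ hq₂ Ψ)).functor) := by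
  obtain ⟨i⟩ := hsq
  let J₁ : PreFrobenioid.Istr F₁ ⥤ (ofFunctor Φ₁ F₁).Istr :=
    ObjectProperty.ιOfLE (PreFrobenioid.isotropicObjects_le_ofFunctor F₁)
  let J₂ : PreFrobenioid.Istr F₂ ⥤ (ofFunctor Φ₂ F₂).Istr :=
    ObjectProperty.ιOfLE (PreFrobenioid.isotropicObjects_le_ofFunctor F₂)
  let K₁ : (ofFunctor Φ₁ F₁).Istr ⥤ PreFrobenioid.Istr F₁ :=
    ObjectProperty.ιOfLE (PreFrobenioid.isotropicObjects_ofFunctor_le F₁)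
  let K₂ : (ofFunctor Φ₂ F₂).Istr ⥤ PreFrobenioid.Istr F₂ :=
    ObjectProperty.ιOfLE (PreFrobenioid.isotropicObjects_ofFunctor_le F₂)
  let G := Ψ.congrFullSubcategory (isotropicObjects_ofFunctor_inverseImage hF₁ hq₁ hq₂ Ψ)
  -- "the restriction of the isotropification functor to `C^istr` is isomorphic to the identity"
  let ρ₁ : (ofFunctor Φ₁ F₁).istrι ⋙ (PreFrobenioid.isotropification hF₁ ⋙ J₁) ≅ 𝟭 _ :=
    Functor.isoWhiskerLeft K₁ (Functor.isoWhiskerRight (PreFrobenioid.isotropificationRestrictIso hF₁) J₁)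
  let ρ₂ : (ofFunctor Φ₂ F₂).istrι ⋙ (PreFrobenioid.isotropification hF₂ ⋙ J₂) ≅ 𝟭 _ :=
    Functor.isoWhiskerLeft K₂ (Functor.isoWhiskerRight (PreFrobenioid.isotropificationRestrictIso hF₂) J₂)
  -- `Ψ^istr ≅ (C₁^istr ⊆ C₁) ⋙ Ψ ⋙ (C₂ → C₂^istr)`
  let c₁ : Ψistr ≅ (ofFunctor Φ₁ F₁).istrι ⋙ Ψ.functor ⋙ (PreFrobenioid.isotropification hF₂ ⋙ J₂) :=
    Ψistr.leftUnitor.symm ≪≫ Functor.isoWhiskerRight ρ₁.symm Ψistr ≪≫ Functor.associator _ _ _ ≪≫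
      Functor.isoWhiskerLeft _ i.symm
  -- the restriction `G` of `Ψ`: `(C₁^istr ⊆ C₁) ⋙ Ψ = G ⋙ (C₂^istr ⊆ C₂)` on the nose
  let c₂ : G.functor ≅ (ofFunctor Φ₁ F₁).istrι ⋙ Ψ.functor ⋙ (PreFrobenioid.isotropification hF₂ ⋙ J₂) :=
    G.functor.rightUnitor.symm ≪≫ Functor.isoWhiskerLeft G.functor ρ₂.symm
  exact ⟨c₁ ≪≫ c₂.symm⟩

/-- **[FrdI] Thm. 3.4 (iv), the unit-trivialisation square, at EVERY `Ψ^istr` as in Thm. 3.4 (i), from the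
typed preservation part of (iv)**: for Frobenioids of quasi-isotropic type, an equivalence `Ψ` such that the typed
`PreFrobenioidData.Thm34iv` holds for `Ψ` and `Ψ⁻¹`, and ANY functor `Ψ^istr : C₁^istr ⥤ C₂^istr` making the square
of Thm. 3.4 (i) with the isotropification functors `1`-commute, the typed `PreFrobenioidData.Thm34iv_untr` holds at
`(ofFunctor Φ₁ F₁, ofFunctor Φ₂ F₂, Ψ, Ψ^istr)` (`thm34iv_untr_ofFunctor_of_thm34iv` transported along
`Ψ^istr ≅` restriction). [cite: MochizukiFrdI2008, Thm. 3.4 (iv) p.63] -/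
theorem thm34iv_untr_ofFunctor_of_thm34iv_of_oneCommutes (hF₁ : PreFrobenioid.IsFrobenioid F₁)
    (hF₂ : PreFrobenioid.IsFrobenioid F₂) (hq₁ : (ofFunctor Φ₁ F₁).IsOfQuasiIsotropicType)
    (hq₂ : (ofFunctor Φ₂ F₂).IsOfQuasiIsotropicType) (Ψ : C₁ ≌ C₂)
    (h4 : (ofFunctor Φ₁ F₁).Thm34iv (ofFunctor Φ₂ F₂) Ψ) (h4' : (ofFunctor Φ₂ F₂).Thm34iv (ofFunctor Φ₁ F₁) Ψ.symm)
    (Ψistr : (ofFunctor Φ₁ F₁).Istr ⥤ (ofFunctor Φ₂ F₂).Istr)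
    (hsq : OneCommutes Ψ.functor
      (PreFrobenioid.isotropification hF₂ ⋙ ObjectProperty.ιOfLE (PreFrobenioid.isotropicObjects_le_ofFunctor F₂))
      (PreFrobenioid.isotropification hF₁ ⋙ ObjectProperty.ιOfLE (PreFrobenioid.isotropicObjects_le_ofFunctor F₁))
      Ψistr) :
    (ofFunctor Φ₁ F₁).Thm34iv_untr (ofFunctor Φ₂ F₂) Ψ Ψistr := by
  haveI := isClosedUnderIsomorphisms_isotropicObjects_ofFunctor (Φ₂ := Φ₂) hF₂
  obtain ⟨e⟩ := nonempty_iso_congrFullSubcategory_of_oneCommutes hF₁ hF₂ hq₁ hq₂ Ψ Ψistr hsq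
  exact Thm34iv_untr.of_iso _ _ Ψ e.symm (thm34iv_untr_ofFunctor_of_thm34iv hF₁ hF₂ hq₁ hq₂ Ψ h4 h4')

end Two

end FrdI

/-! ### Non-vacuity at a genuine instance: the degree model, `Ψ = 𝟭`, THE `Ψ^istr` -/

namespace DegreeModel

open CategoryTheory PreFrobenioidData

/-- **The typed `Thm34iv_untr` HOLDS at the degree model, `Ψ = 𝟭` and THE `Ψ^istr`** (the restriction of `𝟭`
to `C^istr`; quasi-isotropic type from `DegreeModel.isOfStandardType`; Thm. 3.4 (iv) for `𝟭` over the FSM-type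
one-morphism base by `FrdI.thm34iv_ofFunctor_of_isOfFSMType'`) — contrast `DegreeModel.not_thm34iv_untr_const`
(same `S`, same `Ψ`, junk `Ψ^istr`). [cite: MochizukiFrdI2008, Thm. 3.4 (iv) p.63] -/
theorem thm34iv_untr_refl :
    haveI := FrdI.isClosedUnderIsomorphisms_isotropicObjects_ofFunctor (Φ₂ := natΦ) hF
    (ModelFrobenioid.data natΦ B DivB).Thm34iv_untr (ModelFrobenioid.data natΦ B DivB)
      (CategoryTheory.Equivalence.refl (C := C))
      ((CategoryTheory.Equivalence.refl (C := C)).congrFullSubcategory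
        (FrdI.isotropicObjects_ofFunctor_inverseImage hF isOfStandardType.quasiIsotropic
          isOfStandardType.quasiIsotropic (CategoryTheory.Equivalence.refl (C := C)))).functor :=
  haveI := FrdI.isClosedUnderIsomorphisms_isotropicObjects_ofFunctor (Φ₂ := natΦ) hF
  FrdI.thm34iv_untr_ofFunctor_of_thm34iv hF hF isOfStandardType.quasiIsotropic isOfStandardType.quasiIsotropic _
    (FrdI.thm34iv_ofFunctor_of_isOfFSMType' hF hF isOfFSMType_D isOfFSMType_D _)
    (FrdI.thm34iv_ofFunctor_of_isOfFSMType' hF hF isOfFSMType_D isOfFSMType_D _)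

/-- **… with all antecedents discharged**: (a) standard type, (b) `HypB`, (c) the one-morphism base is
Frobenius-slim — so the CONCLUSION of Thm. 3.4 (iv) (a `1`-unique equivalence `Ψ^un-tr` over THE `Ψ^istr`, rigid
composites for the slim base) holds outright for the degree model. [cite: MochizukiFrdI2008, Thm. 3.4 (iv) p.63] -/
theorem thm34iv_untr_refl_conclusion :
    haveI := FrdI.isClosedUnderIsomorphisms_isotropicObjects_ofFunctor (Φ₂ := natΦ) hF
    ∃ Ψuntr : ((ModelFrobenioid.data natΦ B DivB).Untr ⥤ (ModelFrobenioid.data natΦ B DivB).Untr),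
      OneUniqueSquare
          ((CategoryTheory.Equivalence.refl (C := C)).congrFullSubcategory
            (FrdI.isotropicObjects_ofFunctor_inverseImage hF isOfStandardType.quasiIsotropic
              isOfStandardType.quasiIsotropic (CategoryTheory.Equivalence.refl (C := C)))).functor
          (ModelFrobenioid.data natΦ B DivB).toUntr (ModelFrobenioid.data natΦ B DivB).toUntr Ψuntr ∧
        (IsSlim D → IsSlim D →
          IsRigidFunctor
              (((CategoryTheory.Equivalence.refl (C := C)).congrFullSubcategory
                  (FrdI.isotropicObjects_ofFunctor_inverseImage hF isOfStandardType.quasiIsotropic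
                    isOfStandardType.quasiIsotropic (CategoryTheory.Equivalence.refl (C := C)))).functor ⋙
                (ModelFrobenioid.data natΦ B DivB).toUntr) ∧
            IsRigidFunctor ((ModelFrobenioid.data natΦ B DivB).toUntr ⋙ Ψuntr)) :=
  thm34iv_untr_refl isOfStandardType isOfStandardType hypB isFrobeniusSlim_D isFrobeniusSlim_D

end DegreeModel

end Literature.AlgebraicGeometry.Frobenioids
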